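import Mathlib
import HarnessLib
import Summits.HubbardSuperconductivity.HubbardSuperconductivity.Theorems.KLProgrammeKLRegimeEngineIsoTuplePatterns

/-!
# Route `KLProgramme` — crux K3 ENGINE (stmt-HubbardSuperconductivity-20437 `KLRegimeEngineV17F2`), ROW (b) `stub_engine_step_norms` (e78dfb33d2f7),
# binder #6 `hplainE1` BY TYPE, step 1: EVERY spin/charge pattern of a WEIGHTED PINNED four-leg line of `𝒱ₙ[K]` from the ONE Cooper pattern
# `(ψ⁺↑, ψ⁺↓, ψ⁻↑, ψ⁻↓)` at every pinned leg — factor `2`, no kernel sups (cell gate-hubbard-kl, seat p3 g25)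

Weighted twin of `…EngineIsoTuplePatterns` (k3c2-p2 g12), which reduces the UNWEIGHTED class-#6 size `fixedTupleL1` (pin at leg `0`, kept there by
translation invariance).  The `hplainE1` binder of `A24a1G14.stub_engine_step_norms_of_E1data₃` and the conclusion of (T7w)
`TorusFourierL2.wplainFourLegLine_of_momentumRepresentation` are WEIGHTED pinned sums `ε·Σ_{x : x q = y} w(x)·‖W_Ω(x)‖` with the tree weight
`w(x) = klScaleWt_j(positions of x)`; such a weight is invariant under leg permutations, so a leg permutation moves only the pinned leg
(`Σ_{x : x q = y} w(x)‖W_{Ω∘π}(x)‖ = Σ_{z : z (π q) = y} w(z)‖W_Ω(z)‖`, joint antisymmetry `sectorisedKernel_comp_perm` — no conservation needed) and a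
hypothesis at EVERY pinned leg `q` replaces the translation argument.  With the exact symmetries of `𝒱ₙ[K] = klEffectiveAction … K e₀ n` (charge / `S_z`
selection `sectorisedKernel_klEffectiveAction_eq_zero_of_charge/_of_spin`, spin flip `…_spinFlip`, the quartic `SU(2)` Ward identity `…_sameSpin`):

* §1 `wpinSum_sectorisedKernel_comp_perm` (any polynomial, any leg-symmetric weight) and the three bookkeeping one-liners;
* §2 **`wpinSum_klEffectiveAction_stdCharge_le_two_mul`** — charges `(+,−,+,−)`, ANY spins, from the standard pattern (spins `(↑,↑,↓,↓)`) at all pins: `≤ 2·S`;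
* §3 **`wpinSum_klEffectiveAction_le_two_mul_of_std`** — ANY label 4-tuple `Ω`, any pin: `≤ 2·S`;
* §4 **`wpinSum_klEffectiveAction_le_two_mul_of_cooperPattern`** — the same from the (T7w) pattern (charges `(+,+,−,−)`, spins `(↑,↓,↑,↓)`), the leg
  order in which (T7w) reads a pair-transfer momentum representation of the `↑↓` Cooper channel.
Everything is proved; no definitions; nothing about the model is asserted beyond its exact symmetries; nothing asserts `hplainE1`, row (b), any stub of
20437, K3, U₀, the window or superconductivity.  References: BGM 2006 §2.1 symmetries (1)–(3), §2.3 (2.17), §2.7 (2.70)–(2.71a)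
[cite: BenfattoGiulianiMastropietro2006].
-/

noncomputable section

namespace Summit.HubbardSuperconductivity.HubbardSuperconductivity.Theorems.EngineV8

set_option linter.dupNamespace false -- summit = problem name (single-conjunct summit), D-0017

open Classical
open Real Finset Complex Literature.MathematicalPhysics.QuantumLattice Literature.Probability.LatticeModels GrassmannAlgebra
open Summit.HubbardSuperconductivity.HubbardSuperconductivity.Theorems.KLProgrammeLegKernels
open Summit.HubbardSuperconductivity.HubbardSuperconductivity.Theorems.KLRegimeSplit
open Summit.HubbardSuperconductivity.HubbardSuperconductivity.Theorems.KLRegimeWick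

variable {L M : ℕ} [NeZero L] [NeZero M]

/-! ## §1 Weighted pinned sums: leg permutations and bookkeeping -/

section Book

variable {N : ℕ}

omit [NeZero M] in
/-- **A leg permutation moves only the pin of a leg-symmetrically weighted pinned sum** (any polynomial `G`, any family `F`):
`Σ_{x : x q = y} w(x)·‖W_{Ω∘σ}(x)‖ = Σ_{z : z (σ q) = y} w(z)·‖W_Ω(z)‖` (joint antisymmetry + reindexing `x = z ∘ σ`). [folklore] -/
theorem wpinSum_sectorisedKernel_comp_perm {m : ℕ} (β : ℝ) (F : Fin N → FreqMomentum L M → ℂ) (G : HubbardGrassmann L M)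
    (w : (Fin m → SpaceTimeIdx L M) → ℝ) (hw : ∀ (σ : Equiv.Perm (Fin m)) (x : Fin m → SpaceTimeIdx L M), w (x ∘ σ) = w x)
    (σ : Equiv.Perm (Fin m)) (Ω : Fin m → SectorLeg N) (q : Fin m) (y : SpaceTimeIdx L M) :
    ∑ x ∈ univ.filter (fun x : Fin m → SpaceTimeIdx L M => x q = y), w x * ‖sectorisedKernel L M β F G m (Ω ∘ σ) x‖ =
      ∑ z ∈ univ.filter (fun z : Fin m → SpaceTimeIdx L M => z (σ q) = y), w z * ‖sectorisedKernel L M β F G m Ω z‖ := by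
  set e : (Fin m → SpaceTimeIdx L M) ≃ (Fin m → SpaceTimeIdx L M) := σ.symm.arrowCongr (Equiv.refl _) with he_def
  have he : ∀ z : Fin m → SpaceTimeIdx L M, e z = z ∘ σ := fun z => by
    funext i; simp [he_def, Equiv.arrowCongr_apply]
  symm
  refine sum_equiv e (fun z => ?_) (fun z _ => ?_)
  · simp only [mem_filter, mem_univ, true_and, he, Function.comp_apply]
  · rw [he, hw, sectorisedKernel_comp_perm, norm_mul]
    have h1 : ‖(((Equiv.Perm.sign σ : ℤ)) : ℂ)‖ = 1 := by
      rcases Int.units_eq_one_or (Equiv.Perm.sign σ) with h | h <;> simp [h]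
    rw [h1, one_mul]

omit [NeZero M] in
/-- A tuple on which the kernel vanishes identically has weighted pinned sums `0`. [folklore] -/
theorem wpinSum_eq_zero_of_forall {m : ℕ} (W : (Fin m → SectorLeg N) → (Fin m → SpaceTimeIdx L M) → ℂ)
    (w : (Fin m → SpaceTimeIdx L M) → ℝ) (Ω : Fin m → SectorLeg N) (h : ∀ x, W Ω x = 0) (ε : ℝ) (q : Fin m) (y : SpaceTimeIdx L M) :
    ε * ∑ x ∈ univ.filter (fun x : Fin m → SpaceTimeIdx L M => x q = y), w x * ‖W Ω x‖ = 0 := by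
  rw [sum_eq_zero fun x _ => by rw [h, norm_zero, mul_zero], mul_zero]

omit [NeZero M] in
/-- Pointwise-equal kernels have equal weighted pinned sums. [folklore] -/
theorem wpinSum_congr_of_forall {m : ℕ} (W : (Fin m → SectorLeg N) → (Fin m → SpaceTimeIdx L M) → ℂ)
    (w : (Fin m → SpaceTimeIdx L M) → ℝ) (Ω Ω' : Fin m → SectorLeg N) (h : ∀ x, W Ω x = W Ω' x) (ε : ℝ) (q : Fin m) (y : SpaceTimeIdx L M) :
    ε * ∑ x ∈ univ.filter (fun x : Fin m → SpaceTimeIdx L M => x q = y), w x * ‖W Ω x‖ =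
      ε * ∑ x ∈ univ.filter (fun x : Fin m → SpaceTimeIdx L M => x q = y), w x * ‖W Ω' x‖ := by
  simp_rw [h]

omit [NeZero M] in
/-- A kernel that is pointwise the sum of two others has weighted pinned sums at most the sum of theirs (`ε, w ≥ 0`). [folklore] -/
theorem wpinSum_le_add_of_forall {m : ℕ} (W : (Fin m → SectorLeg N) → (Fin m → SpaceTimeIdx L M) → ℂ)
    (w : (Fin m → SpaceTimeIdx L M) → ℝ) (hw0 : ∀ x, 0 ≤ w x) (Ω Ω₁ Ω₂ : Fin m → SectorLeg N) (h : ∀ x, W Ω x = W Ω₁ x + W Ω₂ x)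
    {ε : ℝ} (hε : 0 ≤ ε) (q : Fin m) (y : SpaceTimeIdx L M) :
    ε * ∑ x ∈ univ.filter (fun x : Fin m → SpaceTimeIdx L M => x q = y), w x * ‖W Ω x‖ ≤
      ε * ∑ x ∈ univ.filter (fun x : Fin m → SpaceTimeIdx L M => x q = y), w x * ‖W Ω₁ x‖ +
        ε * ∑ x ∈ univ.filter (fun x : Fin m → SpaceTimeIdx L M => x q = y), w x * ‖W Ω₂ x‖ := by
  rw [← mul_add, ← sum_add_distrib]
  refine mul_le_mul_of_nonneg_left (sum_le_sum fun x _ => ?_) hε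
  rw [← mul_add, h]
  exact mul_le_mul_of_nonneg_left (norm_add_le _ _) (hw0 x)

end Book

/-! ## §2 Charges `(+,−,+,−)`, any spins, weighted, every pin -/

section StdCharge

variable {N : ℕ}

/-- **Charges `(+,−,+,−)`, ANY spins, WEIGHTED, EVERY pin**: for a leg-symmetric weight `w ≥ 0` and `ε ≥ 0`, if every standard tuple
`((ω i, (0,0,1,1) i), (0,1,0,1) i)` has `ε·Σ_{x : x q = y} w(x)‖W(x)‖ ≤ S` at every pinned leg `q` and pin `y`, then so does — up to the factor `2` of the
Ward identity — every tuple `((ω i, s i), (0,1,0,1) i)`: ten spin strings vanish by `S_z`, `(↓,↓,↑,↑)`/`(↓,↓,↓,↓)` are spin flips, `(↑,↓,↓,↑)`/`(↓,↑,↑,↓)` are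
the leg transpositions `(1 3)`/`(0 2)` (the pin moves with the leg), the equal-spin strings are the sectorised Ward sum of two.
[cite: BenfattoGiulianiMastropietro2006, §2.1 (1)-(3), §2.7 (2.70)-(2.71a)] -/
theorem wpinSum_klEffectiveAction_stdCharge_le_two_mul (β : ℝ) (F : Fin N → FreqMomentum L M → ℂ) (U μ : ℝ) (K : TrigPolyC4v) (e₀ : ℝ) (n : ℕ)
    (w : (Fin 4 → SpaceTimeIdx L M) → ℝ) (hw : ∀ (σ : Equiv.Perm (Fin 4)) (x : Fin 4 → SpaceTimeIdx L M), w (x ∘ σ) = w x) (hw0 : ∀ x, 0 ≤ w x)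
    {ε S : ℝ} (hε : 0 ≤ ε) (hS0 : 0 ≤ S)
    (hS : ∀ (ω : Fin 4 → Fin N) (q : Fin 4) (y : SpaceTimeIdx L M),
      ε * ∑ x ∈ univ.filter (fun x : Fin 4 → SpaceTimeIdx L M => x q = y),
        w x * ‖sectorisedKernel L M β F (klEffectiveAction L M β U μ K e₀ n) 4 (fun i => ((ω i, ![(0 : Fin 2), 0, 1, 1] i), ![(0 : Fin 2), 1, 0, 1] i)) x‖ ≤ S)
    (ω : Fin 4 → Fin N) (s : Fin 4 → Fin 2) (q : Fin 4) (y : SpaceTimeIdx L M) :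
    ε * ∑ x ∈ univ.filter (fun x : Fin 4 → SpaceTimeIdx L M => x q = y),
        w x * ‖sectorisedKernel L M β F (klEffectiveAction L M β U μ K e₀ n) 4 (fun i => ((ω i, s i), ![(0 : Fin 2), 1, 0, 1] i)) x‖ ≤ 2 * S := by
  set G := klEffectiveAction L M β U μ K e₀ n with hG
  set W := sectorisedKernel L M β F G 4 with hWdef
  -- the weighted pinned line of a label tuple at the pin `(q, y)`
  set Lw : (Fin 4 → SectorLeg N) → Fin 4 → SpaceTimeIdx L M → ℝ := fun Ω q' y' =>
    ε * ∑ x ∈ univ.filter (fun x : Fin 4 → SpaceTimeIdx L M => x q' = y'), w x * ‖W Ω x‖ with hLw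
  -- spin patterns on the fixed sectors and charges
  set pat : (Fin 4 → Fin N) → (Fin 4 → Fin 2) → Fin 4 → SectorLeg N := fun w' τ i => ((w' i, τ i), ![(0 : Fin 2), 1, 0, 1] i) with hpat
  have hstd : ∀ (w' : Fin 4 → Fin N) (q' : Fin 4) (y' : SpaceTimeIdx L M), Lw (pat w' ![0, 0, 1, 1]) q' y' ≤ S := fun w' q' y' => hS w' q' y'
  show Lw (pat ω s) q y ≤ 2 * S
  -- S_z selection
  have hsel : ∀ τ : Fin 4 → Fin 2,
      (∑ i, (if (pat ω τ i).2 = 0 then (1 : ℤ) else -1) * (if (pat ω τ i).1.2 = 0 then 1 else 0)) ≠ 0 → Lw (pat ω τ) q y ≤ 2 * S := by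
    intro τ hne
    have h0 : Lw (pat ω τ) q y = 0 :=
      wpinSum_eq_zero_of_forall W w (pat ω τ) (fun x => sectorisedKernel_klEffectiveAction_eq_zero_of_spin β F U μ K e₀ n _ hne x) ε q y
    rw [h0]; positivity
  have hP : ∀ a b c d : Fin 2, pat ω ![a, b, c, d] = ![((ω 0, a), 0), ((ω 1, b), 1), ((ω 2, c), 0), ((ω 3, d), 1)] := by
    intro a b c d; funext i; fin_cases i <;> rfl
  have z0001 := hsel ![0, 0, 0, 1] (by
    simp only [hP, Fin.sum_univ_four, Fin.isValue, Matrix.cons_val_zero, Matrix.cons_val_one, Matrix.cons_val_two,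
      Matrix.cons_val_three]
    norm_num)
  have z0010 := hsel ![0, 0, 1, 0] (by
    simp only [hP, Fin.sum_univ_four, Fin.isValue, Matrix.cons_val_zero, Matrix.cons_val_one, Matrix.cons_val_two,
      Matrix.cons_val_three]
    norm_num)
  have z0100 := hsel ![0, 1, 0, 0] (by
    simp only [hP, Fin.sum_univ_four, Fin.isValue, Matrix.cons_val_zero, Matrix.cons_val_one, Matrix.cons_val_two,
      Matrix.cons_val_three]
    norm_num)
  have z1000 := hsel ![1, 0, 0, 0] (by
    simp only [hP, Fin.sum_univ_four, Fin.isValue, Matrix.cons_val_zero, Matrix.cons_val_one, Matrix.cons_val_two,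
      Matrix.cons_val_three]
    norm_num)
  have z0111 := hsel ![0, 1, 1, 1] (by
    simp only [hP, Fin.sum_univ_four, Fin.isValue, Matrix.cons_val_zero, Matrix.cons_val_one, Matrix.cons_val_two,
      Matrix.cons_val_three]
    norm_num)
  have z1011 := hsel ![1, 0, 1, 1] (by
    simp only [hP, Fin.sum_univ_four, Fin.isValue, Matrix.cons_val_zero, Matrix.cons_val_one, Matrix.cons_val_two,
      Matrix.cons_val_three]
    norm_num)
  have z1101 := hsel ![1, 1, 0, 1] (by
    simp only [hP, Fin.sum_univ_four, Fin.isValue, Matrix.cons_val_zero, Matrix.cons_val_one, Matrix.cons_val_two,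
      Matrix.cons_val_three]
    norm_num)
  have z1110 := hsel ![1, 1, 1, 0] (by
    simp only [hP, Fin.sum_univ_four, Fin.isValue, Matrix.cons_val_zero, Matrix.cons_val_one, Matrix.cons_val_two,
      Matrix.cons_val_three]
    norm_num)
  have z0101 := hsel ![0, 1, 0, 1] (by
    simp only [hP, Fin.sum_univ_four, Fin.isValue, Matrix.cons_val_zero, Matrix.cons_val_one, Matrix.cons_val_two,
      Matrix.cons_val_three]
    norm_num)
  have z1010 := hsel ![1, 0, 1, 0] (by
    simp only [hP, Fin.sum_univ_four, Fin.isValue, Matrix.cons_val_zero, Matrix.cons_val_one, Matrix.cons_val_two,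
      Matrix.cons_val_three]
    norm_num)
  -- spin flip: `(1,1,0,0)` and `(1,1,1,1)`
  have hflip : ∀ τ : Fin 4 → Fin 2, ∀ x, W (pat ω (fun i => Equiv.swap (0 : Fin 2) 1 (τ i))) x = W (pat ω τ) x :=
    fun τ x => sectorisedKernel_klEffectiveAction_spinFlip β F U μ K e₀ n (pat ω τ) x
  have hflipL : ∀ τ : Fin 4 → Fin 2, Lw (pat ω (fun i => Equiv.swap (0 : Fin 2) 1 (τ i))) q y = Lw (pat ω τ) q y :=
    fun τ => wpinSum_congr_of_forall W w _ _ (hflip τ) ε q y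
  have f1100 : Lw (pat ω ![1, 1, 0, 0]) q y = Lw (pat ω ![0, 0, 1, 1]) q y := by
    rw [← hflipL]; congr 2; funext i; fin_cases i <;> rfl
  have f1111 : Lw (pat ω ![1, 1, 1, 1]) q y = Lw (pat ω ![0, 0, 0, 0]) q y := by
    rw [← hflipL]; congr 2; funext i; fin_cases i <;> rfl
  -- leg transpositions: `(0,1,1,0)` and `(1,0,0,1)` (the pin moves with the leg)
  have hperm : ∀ (σ : Equiv.Perm (Fin 4)) (Ω : Fin 4 → SectorLeg N) (q' : Fin 4) (y' : SpaceTimeIdx L M), Lw (Ω ∘ σ) q' y' = Lw Ω (σ q') y' := by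
    intro σ Ω q' y'
    simp only [hLw]
    rw [hWdef, wpinSum_sectorisedKernel_comp_perm β F G w hw σ Ω q' y']
  have c0110 : ∀ (q' : Fin 4) (y' : SpaceTimeIdx L M), Lw (pat ω ![0, 1, 1, 0]) q' y' ≤ S := by
    intro q' y'
    have hX : pat (ω ∘ Equiv.swap (1 : Fin 4) 3) ![0, 0, 1, 1] ∘ (Equiv.swap (1 : Fin 4) 3) = pat ω ![0, 1, 1, 0] := by
      funext i; fin_cases i <;> rfl
    rw [← hX, hperm]
    exact hstd _ _ _
  have c1001 : ∀ (q' : Fin 4) (y' : SpaceTimeIdx L M), Lw (pat ω ![1, 0, 0, 1]) q' y' ≤ S := by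
    intro q' y'
    have hX : pat (ω ∘ Equiv.swap (0 : Fin 4) 2) ![0, 0, 1, 1] ∘ (Equiv.swap (0 : Fin 4) 2) = pat ω ![1, 0, 0, 1] := by
      funext i; fin_cases i <;> rfl
    rw [← hX, hperm]
    exact hstd _ _ _
  -- the equal-spin patterns: Ward at the sectorised level
  have c0000 : Lw (pat ω ![0, 0, 0, 0]) q y ≤ 2 * S := by
    have hpt : ∀ x, W (pat ω ![0, 0, 0, 0]) x = W (pat ω ![0, 0, 1, 1]) x + W (pat ω ![1, 0, 0, 1]) x := by
      intro x
      have e0 : pat ω ![0, 0, 0, 0] = fun i => ((ω i, (0 : Fin 2)), ![(0 : Fin 2), 1, 0, 1] i) := by funext i; fin_cases i <;> rfl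
      rw [e0]
      exact sectorisedKernel_klEffectiveAction_sameSpin β F U μ K e₀ n ω x
    have h := wpinSum_le_add_of_forall W w hw0 _ _ _ hpt hε q y
    have h1 := hstd ω q y
    have h2 := c1001 q y
    simp only [hLw] at h1 h2 ⊢
    linarith
  have c1111 : Lw (pat ω ![1, 1, 1, 1]) q y ≤ 2 * S := by rw [f1111]; exact c0000
  have c0011 : Lw (pat ω ![0, 0, 1, 1]) q y ≤ 2 * S := by linarith [hstd ω q y]
  have c1100 : Lw (pat ω ![1, 1, 0, 0]) q y ≤ 2 * S := by rw [f1100]; exact c0011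
  -- case on the spins
  have hs : s = ![s 0, s 1, s 2, s 3] := by funext i; fin_cases i <;> rfl
  rw [hs]
  generalize s 0 = a₀; generalize s 1 = a₁; generalize s 2 = a₂; generalize s 3 = a₃
  fin_cases a₀ <;> fin_cases a₁ <;> fin_cases a₂ <;> fin_cases a₃
  all_goals try simp only [Fin.zero_eta, Fin.mk_one, Fin.isValue]
  · exact c0000
  · exact z0001
  · exact z0010
  · exact c0011
  · exact z0100
  · exact z0101
  · linarith [c0110 q y]
  · exact z0111
  · exact z1000
  · linarith [c1001 q y]
  · exact z1010
  · exact z1011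
  · exact c1100
  · exact z1101
  · exact z1110
  · exact c1111

end StdCharge

/-! ## §3 Any charges, weighted, every pin -/

section AnyPattern

variable {N : ℕ}

/-- **ALL spin AND charge patterns, WEIGHTED, EVERY pin**: under the standard-pattern hypothesis of §2 (leg-symmetric weight `w ≥ 0`, `ε ≥ 0`), EVERY label
4-tuple `Ω` has `ε·Σ_{x : x q = y} w(x)‖W_Ω(x)‖ ≤ 2·S` at every pin — charge-unbalanced tuples vanish (`sectorisedKernel_klEffectiveAction_eq_zero_of_charge`),
balanced ones are leg permutations of the `(+,−,+,−)` order of §2 (the pin moves with the leg, `wpinSum_sectorisedKernel_comp_perm`).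
[cite: BenfattoGiulianiMastropietro2006, §2.1 (1)-(3), §2.7 (2.70)-(2.71a)] -/
theorem wpinSum_klEffectiveAction_le_two_mul_of_std (β : ℝ) (F : Fin N → FreqMomentum L M → ℂ) (U μ : ℝ) (K : TrigPolyC4v) (e₀ : ℝ) (n : ℕ)
    (w : (Fin 4 → SpaceTimeIdx L M) → ℝ) (hw : ∀ (σ : Equiv.Perm (Fin 4)) (x : Fin 4 → SpaceTimeIdx L M), w (x ∘ σ) = w x) (hw0 : ∀ x, 0 ≤ w x)
    {ε S : ℝ} (hε : 0 ≤ ε) (hS0 : 0 ≤ S)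
    (hS : ∀ (ω : Fin 4 → Fin N) (q : Fin 4) (y : SpaceTimeIdx L M),
      ε * ∑ x ∈ univ.filter (fun x : Fin 4 → SpaceTimeIdx L M => x q = y),
        w x * ‖sectorisedKernel L M β F (klEffectiveAction L M β U μ K e₀ n) 4 (fun i => ((ω i, ![(0 : Fin 2), 0, 1, 1] i), ![(0 : Fin 2), 1, 0, 1] i)) x‖ ≤ S)
    (Ω : Fin 4 → SectorLeg N) (q : Fin 4) (y : SpaceTimeIdx L M) :
    ε * ∑ x ∈ univ.filter (fun x : Fin 4 → SpaceTimeIdx L M => x q = y),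
        w x * ‖sectorisedKernel L M β F (klEffectiveAction L M β U μ K e₀ n) 4 Ω x‖ ≤ 2 * S := by
  set G := klEffectiveAction L M β U μ K e₀ n with hG
  set W := sectorisedKernel L M β F G 4 with hWdef
  set Lw : (Fin 4 → SectorLeg N) → Fin 4 → SpaceTimeIdx L M → ℝ := fun Ω q' y' =>
    ε * ∑ x ∈ univ.filter (fun x : Fin 4 → SpaceTimeIdx L M => x q' = y'), w x * ‖W Ω x‖ with hLw
  have hperm : ∀ (σ : Equiv.Perm (Fin 4)) (Ω : Fin 4 → SectorLeg N) (q' : Fin 4) (y' : SpaceTimeIdx L M), Lw (Ω ∘ σ) q' y' = Lw Ω (σ q') y' := by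
    intro σ Ω q' y'
    simp only [hLw]
    rw [hWdef, wpinSum_sectorisedKernel_comp_perm β F G w hw σ Ω q' y']
  -- coordinates of `Ω`
  set w₀ : Fin 4 → Fin N := fun i => (Ω i).1.1 with hw₀
  set s : Fin 4 → Fin 2 := fun i => (Ω i).1.2 with hs
  set c : Fin 4 → Fin 2 := fun i => (Ω i).2 with hc
  set pat : (Fin 4 → Fin 2) → Fin 4 → SectorLeg N := fun γ i => ((w₀ i, s i), γ i) with hpat
  have hΩ : Ω = pat c := by funext i; simp [hpat, hw₀, hs, hc]
  show Lw Ω q y ≤ 2 * S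
  -- the standard order after a leg permutation `τ`
  have hstd : ∀ τ : Equiv.Perm (Fin 4), c ∘ τ = ![0, 1, 0, 1] → Lw (pat c) q y ≤ 2 * S := by
    intro τ hτ
    have e1 : pat c = (pat c ∘ τ) ∘ τ.symm := by funext i; simp
    rw [e1, hperm]
    have hXτ : pat c ∘ τ = fun i => (((w₀ ∘ τ) i, (s ∘ τ) i), ![(0 : Fin 2), 1, 0, 1] i) := by
      funext i
      have hi : c (τ i) = ![(0 : Fin 2), 1, 0, 1] i := congrFun hτ i
      simp only [Function.comp_apply, hpat, hi]
    rw [hXτ]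
    exact wpinSum_klEffectiveAction_stdCharge_le_two_mul β F U μ K e₀ n w hw hw0 hε hS0 hS (w₀ ∘ τ) (s ∘ τ) (τ.symm q) y
  -- charge selection
  have hsel : ∀ γ : Fin 4 → Fin 2, (∑ i, (if (pat γ i).2 = 0 then (1 : ℤ) else -1)) ≠ 0 → Lw (pat γ) q y ≤ 2 * S := by
    intro γ hne
    have h0 : Lw (pat γ) q y = 0 :=
      wpinSum_eq_zero_of_forall W w (pat γ) (fun x => sectorisedKernel_klEffectiveAction_eq_zero_of_charge β F U μ K e₀ n _ hne x) ε q y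
    rw [h0]; positivity
  have hPc : ∀ a b d e : Fin 2, pat ![a, b, d, e] = ![((w₀ 0, s 0), a), ((w₀ 1, s 1), b), ((w₀ 2, s 2), d), ((w₀ 3, s 3), e)] := by
    intro a b d e; funext i; fin_cases i <;> rfl
  rw [hΩ]
  have hcv : c = ![c 0, c 1, c 2, c 3] := by funext i; fin_cases i <;> rfl
  have key : ∀ a b d e : Fin 2, c = ![a, b, d, e] → Lw (pat c) q y ≤ 2 * S := by
    intro a b d e hce
    have unb : ∀ γ : Fin 4 → Fin 2, c = γ → (∑ i, (if (pat γ i).2 = 0 then (1 : ℤ) else -1)) ≠ 0 → Lw (pat c) q y ≤ 2 * S :=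
      fun γ hγ hne => by rw [hγ]; exact hsel γ hne
    have bal : ∀ γ : Fin 4 → Fin 2, c = γ → ∀ τ : Equiv.Perm (Fin 4), γ ∘ τ = ![0, 1, 0, 1] → Lw (pat c) q y ≤ 2 * S :=
      fun γ hγ τ hτ => hstd τ (by rw [hγ]; exact hτ)
    fin_cases a <;> fin_cases b <;> fin_cases d <;> fin_cases e
    all_goals try simp only [Fin.zero_eta, Fin.mk_one, Fin.isValue] at hce
    · exact unb _ hce (by
      simp only [hPc, Fin.sum_univ_four, Fin.isValue, Matrix.cons_val_zero, Matrix.cons_val_one, Matrix.cons_val_two,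
        Matrix.cons_val_three]
      norm_num)
    · exact unb _ hce (by
      simp only [hPc, Fin.sum_univ_four, Fin.isValue, Matrix.cons_val_zero, Matrix.cons_val_one, Matrix.cons_val_two,
        Matrix.cons_val_three]
      norm_num)
    · exact unb _ hce (by
      simp only [hPc, Fin.sum_univ_four, Fin.isValue, Matrix.cons_val_zero, Matrix.cons_val_one, Matrix.cons_val_two,
        Matrix.cons_val_three]
      norm_num)
    · exact bal _ hce (Equiv.swap (1 : Fin 4) 2) (by funext i; fin_cases i <;> rfl)
    · exact unb _ hce (by
      simp only [hPc, Fin.sum_univ_four, Fin.isValue, Matrix.cons_val_zero, Matrix.cons_val_one, Matrix.cons_val_two,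
        Matrix.cons_val_three]
      norm_num)
    · exact bal _ hce (Equiv.refl _) (by funext i; fin_cases i <;> rfl)
    · exact bal _ hce (Equiv.swap (2 : Fin 4) 3) (by funext i; fin_cases i <;> rfl)
    · exact unb _ hce (by
      simp only [hPc, Fin.sum_univ_four, Fin.isValue, Matrix.cons_val_zero, Matrix.cons_val_one, Matrix.cons_val_two,
        Matrix.cons_val_three]
      norm_num)
    · exact unb _ hce (by
      simp only [hPc, Fin.sum_univ_four, Fin.isValue, Matrix.cons_val_zero, Matrix.cons_val_one, Matrix.cons_val_two,
        Matrix.cons_val_three]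
      norm_num)
    · exact bal _ hce (Equiv.swap (0 : Fin 4) 1) (by funext i; fin_cases i <;> rfl)
    · exact bal _ hce ((Equiv.swap (0 : Fin 4) 1) * (Equiv.swap (2 : Fin 4) 3)) (by funext i; fin_cases i <;> rfl)
    · exact unb _ hce (by
      simp only [hPc, Fin.sum_univ_four, Fin.isValue, Matrix.cons_val_zero, Matrix.cons_val_one, Matrix.cons_val_two,
        Matrix.cons_val_three]
      norm_num)
    · exact bal _ hce ((Equiv.swap (1 : Fin 4) 2) * ((Equiv.swap (0 : Fin 4) 1) * (Equiv.swap (2 : Fin 4) 3)))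
        (by funext i; fin_cases i <;> rfl)
    · exact unb _ hce (by
      simp only [hPc, Fin.sum_univ_four, Fin.isValue, Matrix.cons_val_zero, Matrix.cons_val_one, Matrix.cons_val_two,
        Matrix.cons_val_three]
      norm_num)
    · exact unb _ hce (by
      simp only [hPc, Fin.sum_univ_four, Fin.isValue, Matrix.cons_val_zero, Matrix.cons_val_one, Matrix.cons_val_two,
        Matrix.cons_val_three]
      norm_num)
    · exact unb _ hce (by
      simp only [hPc, Fin.sum_univ_four, Fin.isValue, Matrix.cons_val_zero, Matrix.cons_val_one, Matrix.cons_val_two,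
        Matrix.cons_val_three]
      norm_num)
  exact key (c 0) (c 1) (c 2) (c 3) hcv

/-! ## §4 From the Cooper pattern `(ψ⁺↑, ψ⁺↓, ψ⁻↑, ψ⁻↓)` — the (T7w) leg order -/

/-- **ALL label 4-tuples FROM THE COOPER PATTERN** (charges `(+,+,−,−)`, spins `(↑,↓,↑,↓)` — the leg order in which (T7w)
`TorusFourierL2.wplainFourLegLine_of_momentumRepresentation` reads a pair-transfer representation of the `↑↓` channel): for a leg-symmetric weight `w ≥ 0` and
`ε ≥ 0`, if `ε·Σ_{x : x q = y} w(x)‖W(x)‖ ≤ S` for every tuple `((ω i, (0,1,0,1) i), (0,0,1,1) i)` at every pin, then EVERY label 4-tuple has weighted pinned sums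
`≤ 2·S` at every pin (the standard order of §2–§3 is the leg transposition `(1 2)` of the Cooper order).
[cite: BenfattoGiulianiMastropietro2006, §2.1 (1)-(3), §2.7 (2.70)-(2.71a)] -/
theorem wpinSum_klEffectiveAction_le_two_mul_of_cooperPattern (β : ℝ) (F : Fin N → FreqMomentum L M → ℂ) (U μ : ℝ) (K : TrigPolyC4v) (e₀ : ℝ)
    (n : ℕ) (w : (Fin 4 → SpaceTimeIdx L M) → ℝ) (hw : ∀ (σ : Equiv.Perm (Fin 4)) (x : Fin 4 → SpaceTimeIdx L M), w (x ∘ σ) = w x)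
    (hw0 : ∀ x, 0 ≤ w x) {ε S : ℝ} (hε : 0 ≤ ε) (hS0 : 0 ≤ S)
    (hT : ∀ (ω : Fin 4 → Fin N) (q : Fin 4) (y : SpaceTimeIdx L M),
      ε * ∑ x ∈ univ.filter (fun x : Fin 4 → SpaceTimeIdx L M => x q = y),
        w x * ‖sectorisedKernel L M β F (klEffectiveAction L M β U μ K e₀ n) 4 (fun i => ((ω i, ![(0 : Fin 2), 1, 0, 1] i), ![(0 : Fin 2), 0, 1, 1] i)) x‖ ≤ S)
    (Ω : Fin 4 → SectorLeg N) (q : Fin 4) (y : SpaceTimeIdx L M) :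
    ε * ∑ x ∈ univ.filter (fun x : Fin 4 → SpaceTimeIdx L M => x q = y),
        w x * ‖sectorisedKernel L M β F (klEffectiveAction L M β U μ K e₀ n) 4 Ω x‖ ≤ 2 * S := by
  refine wpinSum_klEffectiveAction_le_two_mul_of_std β F U μ K e₀ n w hw hw0 hε hS0 (fun ω q' y' => ?_) Ω q y
  -- the standard tuple is the Cooper tuple of `ω ∘ (1 2)` after the leg transposition `(1 2)`
  have hX : (fun i => (((ω ∘ Equiv.swap (1 : Fin 4) 2) i, ![(0 : Fin 2), 1, 0, 1] i), ![(0 : Fin 2), 0, 1, 1] i)) ∘ (Equiv.swap (1 : Fin 4) 2) =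
      (fun i => ((ω i, ![(0 : Fin 2), 0, 1, 1] i), ![(0 : Fin 2), 1, 0, 1] i) : Fin 4 → SectorLeg N) := by
    funext i; fin_cases i <;> rfl
  rw [← hX, wpinSum_sectorisedKernel_comp_perm β F _ w hw]
  exact hT _ _ _

end AnyPattern

end Summit.HubbardSuperconductivity.HubbardSuperconductivity.Theorems.EngineV8

end
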